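/-
Copyright (c) 2026. All rights reserved.
Released under Apache 2.0 license as described in the file LICENSE.
Authors: abc-iut cell — seat abc-iut-w5-d053 (gen 3; rows «Cor36-K-STEP3» (L4-lead) and «Cor36-CROSS» (I)+(G),
over the blueprint of seat abc-iut-L4-t5).
-/
import Literature.AnabelianGeometry.AbsoluteAnabelian.AbsTopIII.FrobeniusPictureMLFLogGlueCrossAdapter
import Literature.AnabelianGeometry.AbsoluteAnabelian.AbsTopIII.FrobeniusPictureMLFLogGlueCrossInduction
import Literature.AnabelianGeometry.AbsoluteAnabelian.AbsTopIII.FrobeniusPictureMLFLogGlueCrossGenerators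
import Literature.AnabelianGeometry.AbsoluteAnabelian.AbsTopIII.FrobeniusPictureMLFModelProofs
import Literature.AnabelianGeometry.AbsoluteAnabelian.AbsTopIII.LogFrobeniusObservableProofs

/-!
# [AbsTopIII] Cor 3.6 (iii), cores clause — CLOSED from `IotaOverGaloisStmt`, and PROVED AT THE MLF MODEL

S. Mochizuki, *Topics in Absolute Anabelian Geometry III*, Cor. 3.6 (iii) p. 80 (`MochizukiAbsTopIII2015`): "the
family of homotopies that constitutes `𝔖_log` is compatible with the families of homotopies that constitute the core
[...] structures of (i)" — `LogFrobeniusData.LogObsCompatCoresStmt` (abc-iut-L4-t5).  PROOF-ONLY file composing the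
chain p430476 (`pushLogη`, `glueη`) → p431675 (`glueFamily`, reduction to the cross term) → p432316 (cross term ⇐
image form) → p433228 (image form ⇐ generator form, induction on `Saturation`) → p437037 (generator form ⇐
`IotaOverGaloisStmt`, uniqueness of lifts over `ℰ`):

* `logObsCompatCoresStmt_of_iotaOverGalois` — for a log-observable family `H₃`, from `IotaOverGaloisStmt`;
* `logObsCompatCoresStmt_of_iotaOverGaloisStmt` — for EVERY `𝒟` with `IotaOverGaloisStmt` (the `𝔖_log` family
  exists: abc-iut-w4-d095's `observableLogStmt`);
* `AbsTopIII.TFModel.logObsCompatCoresStmt_model` — **AT THE MLF MODEL** of every type `P` and Cor-1.10 datum `I`,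
  unconditionally (`iotaOverGaloisStmt_model`, abc-iut-L4-t5).

HONEST SCOPE: over the abstract data the result is conditional on the named fact `IotaOverGaloisStmt` (F-0360); at the
model it is unconditional.  Model-level ≠ node-level (the lead decides the NODES token).  No claim of the paper beyond
this is asserted; refereed pre-IUT material; nothing here bears on [IUTchIII] Cor. 3.12; typed ≠ discharged.
-/

namespace Literature.AnabelianGeometry.AbsoluteAnabelian

open _root_.CategoryTheory _root_.Quiver

universe u

namespace LogFrobeniusData

open DiagramOfCategories

variable (Δ : LogFrobeniusData.{u})

/-! ### §11 (abc-iut-w5-d053): [AbsTopIII] Cor 3.6 (iii), cores clause — the closers -/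

variable {Δ} in
/-- **[AbsTopIII] Cor 3.6 (iii), cores clause, for a log-observable family, FROM `IotaOverGaloisStmt`.**
[cite: MochizukiAbsTopIII2015, Corollary 3.6 (iii) p.80] -/
theorem logObsCompatCoresStmt_of_iotaOverGalois {H₃ : Δ.sub3.HomotopyFamily} (hH₃ : Δ.IsLogObservableFamily H₃)
    (hι : Δ.IotaOverGaloisStmt) : Δ.LogObsCompatCoresStmt :=
  logObsCompatCoresStmt_of_imageCross hH₃ fun _ _ r p q hh _ r₂ hd h' =>
    imageCross_of_generators hH₃ (generatorCross_of_iotaOverGalois hH₃ hι) ((hH₃.1 p q).mp hh) r hh r₂ hd h'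

/-- **[AbsTopIII] Cor 3.6 (iii), cores clause («the family of homotopies that constitutes `𝔖_log` is compatible
with the families of homotopies that constitute the core structures of (i)»), for EVERY diagram `𝒟` satisfying
`IotaOverGaloisStmt`** — the `𝔖_log` family exists by `observableLogStmt` (abc-iut-w4-d095).
[cite: MochizukiAbsTopIII2015, Corollary 3.6 (iii) p.80] -/
theorem logObsCompatCoresStmt_of_iotaOverGaloisStmt (hι : Δ.IotaOverGaloisStmt) : Δ.LogObsCompatCoresStmt := by
  obtain ⟨H₃, hH₃⟩ := Δ.observableLogStmt
  exact logObsCompatCoresStmt_of_iotaOverGalois hH₃ hι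

end LogFrobeniusData

namespace AbsTopIII.TFModel

variable {p : ℕ} [Fact p.Prime] {P : ObjectProperty (TFModel p)} {D : Type 1} [Category.{1} D]

/-- **[AbsTopIII] Cor 3.6 (iii), cores clause, PROVED AT THE MLF MODEL**: for the model log-Frobenius data of
every type `P` and every Cor-1.10 datum `I`, ONE family of homotopies on `𝒟` contains the `𝔖_log` family and core
families for `(𝒟_{≤4}, ℰ)`, `(𝒟_{≤5}, Anab)`, `(𝒟_{≤6}, ℰ)` — `IotaOverGaloisStmt` holding at the model
(`iotaOverGaloisStmt_model`). [cite: MochizukiAbsTopIII2015, Corollary 3.6 (iii) p.80] -/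
theorem logObsCompatCoresStmt_model (I : AnabelianInput p P D) :
    (monoAnabelianData I).toLogFrobeniusData.LogObsCompatCoresStmt :=
  (monoAnabelianData I).toLogFrobeniusData.logObsCompatCoresStmt_of_iotaOverGaloisStmt (iotaOverGaloisStmt_model I)

end AbsTopIII.TFModel

end Literature.AnabelianGeometry.AbsoluteAnabelian
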